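import Literature.Computability.Complexity.PaulPippengerSzemerediTrotter1983Cells
import HarnessLib

/-!
# Block claims and their local consistency: soundness of the four-alternation re-simulation (PPST 1983, §3)

Literature / complexity toolkit, tenth brick of the inline formalization of
Paul–Pippenger–Szemerédi–Trotter 1983 (`PaulPippengerSzemerediTrotter1983.lean`, fact
`PaulEtAl1983_NTIME_not_subset_DTIME`; roadmap Layer 4, mathematical core, part 3). The
existential player of the four-alternation protocol CLAIMS, for every time block `j` of a
deterministic run, a summary: the finite control and the heights at the block's start, the extreme
heights of the block, and the contents above the block's cut (the lowest height block it touches)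
at its start and at its end. The universal player picks a block; the claims about it are checked
LOCALLY: (C1) re-simulating the block from its claimed start data for `b` steps (on the truncated
stacks, `…Frames.lean`) reproduces the claimed end data, extreme heights and the next block's start
control/heights; (C2) every height block the block touches carries, at the block's start, the
content it had at the end of its last toucher (or initially); (C0) block `0` starts in the initial
configuration. This file defines the claims and the three conditions as PROPOSITIONS about a
family of claims (no machines yet) and proves SOUNDNESS: claims passing all local checks are the
true summaries of the run — by induction along the run, using the re-simulation lemma
(`TM2Frames.run_append_of_truncated`) and the frozen-block lemma
(`TM2Blocks.bpart_run_eq_of_lastToucher`). No property of any segregator is involved: segregators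
only bound the SIZE of the existential guesses (completeness side).

* `TM2Blocks.above`, `below`, `bpartAbove` (a height block read off a top segment) and their
  algebra (`bpart_append_eq_bpartAbove`, `eq_of_chunks_eq`, `eq_of_bpartAbove_eq`: top segments
  with the same height blocks over a covering range are equal);
* `BlockClaim tm` (fields `l`, `var`, `ht`, `mn`, `mx`, `frag`, `efrag`), `loC`, `hiC`, `cutC`,
  `startCfg`; the conditions `CondInit` (C0), `CondSim` (C1), `CondDep` (C2) — propositions about
  the claims, the machine and the initial configuration alone;
* `Correct`, `FullyCorrect`; **`correct_step`** ((C1) is sound), **`frag_correct_of_condDep'`**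
  ((C2) is sound, local form: hypotheses only on the consulted predecessors — the form the
  branch-by-branch protocol needs), `frag_correct_of_condDep`, **`sound`**:
  `CondInit ∧ (∀ j < N, CondSim j) ∧ (∀ j ≤ N, CondDep j) ⟹ ∀ j < N, FullyCorrect j` (and block
  `N` has the true control and heights).

No named fact is introduced (definitions with bodies and theorems only).

## References

* W. J. Paul, N. Pippenger, E. Szemerédi, W. T. Trotter, *On determinism versus non-determinism
  and related problems*, FOCS 1983, 429–438, §3 (the `Σ₄` simulation: guess, for all blocks,
  verify locally) [PaulEtAl1983].
* R. Santhanam, *On separators, segregators and time versus space*, CCC 2001, §1–2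
  [Santhanam2001].
-/

namespace Literature.Computability.Complexity

open Turing Function

namespace TM2Blocks

/-! ### Top segments and height blocks read off them -/

/-- The cells of the stack word `S` (top first) at heights `≥ θ`: the top `|S| - θ` cells.
[folklore] -/
def above {α : Type} (θ : ℕ) (S : List α) : List α := S.take (S.length - θ)

/-- The cells at heights `< θ` (the bottom `min θ |S|` cells). [folklore] -/
def below {α : Type} (θ : ℕ) (S : List α) : List α := S.drop (S.length - θ)

/-- `S = above θ S ++ below θ S`. [folklore] -/
theorem above_append_below {α : Type} (θ : ℕ) (S : List α) : above θ S ++ below θ S = S :=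
  List.take_append_drop _ _

/-- `|below θ S| = θ` when `θ ≤ |S|`. [folklore] -/
theorem length_below {α : Type} {θ : ℕ} {S : List α} (h : θ ≤ S.length) :
    (below θ S).length = θ := by
  simp [below, List.length_drop]; omega

/-- `|above θ S| = |S| - θ`. [folklore] -/
theorem length_above {α : Type} (θ : ℕ) (S : List α) : (above θ S).length = S.length - θ := by
  simp [above, List.length_take]

/-- `above |L| (U ++ L) = U`. [folklore] -/
theorem above_append {α : Type} (U L : List α) : above L.length (U ++ L) = U := by
  simp [above]

/-- The height block `B` read off a top segment `F` sitting above height `θ ≤ B β`. [folklore] -/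
def bpartAbove {α : Type} (β θ B : ℕ) (F : List α) : List α :=
  (F.reverse.drop (B * β - θ)).take β

/-- Dropping past the first list. [folklore] -/
theorem drop_append_of_length_le {α : Type} :
    ∀ {n : ℕ} (l₁ l₂ : List α), l₁.length ≤ n → (l₁ ++ l₂).drop n = l₂.drop (n - l₁.length)
  | n, [], l₂, _ => by simp
  | 0, a :: l₁, l₂, h => by simp at h
  | n + 1, a :: l₁, l₂, h => by
    simp only [List.cons_append, List.drop_succ_cons, List.length_cons, Nat.reduceSubDiff]
    exact drop_append_of_length_le l₁ l₂ (by simpa using h)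

/-- Reading a height block above the cut off the top segment. [folklore] -/
theorem bpart_append_eq_bpartAbove {α : Type} {β θ B : ℕ} (F L : List α) (hL : L.length = θ)
    (hθ : θ ≤ B * β) : bpart β B (F ++ L) = bpartAbove β θ B F := by
  unfold bpart bpartAbove
  rw [List.reverse_append, drop_append_of_length_le _ _ (by rw [List.length_reverse, hL]; exact hθ),
    List.length_reverse, hL]

/-- **Chunkwise equal lists are equal**: two lists of the same length whose windows
`[i β, i β + β)` agree for all `i < m`, with `m β` covering the length, are equal. [folklore] -/
theorem eq_of_chunks_eq {α : Type} (β : ℕ) :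
    ∀ (m : ℕ) (L₁ L₂ : List α), L₁.length = L₂.length → L₁.length ≤ m * β →
      (∀ i, i < m → (L₁.drop (i * β)).take β = (L₂.drop (i * β)).take β) → L₁ = L₂
  | 0, L₁, L₂, hlen, hle, _ => by
    have h1 : L₁ = [] := List.eq_nil_of_length_eq_zero (by simpa using hle)
    have h2 : L₂ = [] := List.eq_nil_of_length_eq_zero (by rw [← hlen]; simpa using hle)
    rw [h1, h2]
  | m + 1, L₁, L₂, hlen, hle, h => by
    have h0 := h 0 (Nat.succ_pos _)
    simp only [Nat.zero_mul, List.drop_zero] at h0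
    have e₁ := List.take_append_drop β L₁
    have e₂ := List.take_append_drop β L₂
    rw [Nat.succ_mul] at hle
    have ih := eq_of_chunks_eq β m (L₁.drop β) (L₂.drop β) (by simp [hlen])
      (by simp only [List.length_drop]; omega)
      (fun i hi => by
        have := h (i + 1) (by omega)
        rw [Nat.succ_mul] at this
        simpa [List.drop_drop, Nat.add_comm] using this)
    rw [← e₁, ← e₂, h0, ih]

/-- **Top segments with the same height blocks over a covering range are equal**: if `F`, `G`
sit above the cut `lo β`, have the same length, that length is covered by the height blocks
`lo … hi` (`|F| + lo β ≤ (hi + 1) β`), and every such height block reads the same off `F` and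
`G`, then `F = G`. [folklore] -/
theorem eq_of_bpartAbove_eq {α : Type} {β lo hi : ℕ} (F G : List α)
    (hlen : F.length = G.length) (hcov : F.length + lo * β ≤ (hi + 1) * β)
    (h : ∀ B, lo ≤ B → B ≤ hi → bpartAbove β (lo * β) B F = bpartAbove β (lo * β) B G) :
    F = G := by
  have hr : F.reverse = G.reverse := by
    refine eq_of_chunks_eq β (hi + 1 - lo) F.reverse G.reverse (by simpa using hlen) ?_ ?_
    · rw [List.length_reverse, Nat.sub_mul, Nat.succ_mul]
      rw [Nat.succ_mul] at hcov
      omega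
    · intro i hi'
      have := h (lo + i) (by omega) (by omega)
      unfold bpartAbove at this
      rwa [show (lo + i) * β - lo * β = i * β by rw [Nat.add_mul]; omega] at this
  simpa using congrArg List.reverse hr

variable (tm : FinTM2)

/-! ### Claims -/

/-- **The claimed summary of a time block**: start label and internal state, start heights,
claimed extreme boundary heights of the block, and the contents above the block's cut at its start
(`frag`, top first) and at its end (`efrag`). [cite: PaulEtAl1983, §3 (the guessed data of the Σ₄ simulation)] -/
structure BlockClaim where
  /-- The label at the block's start (`none` once halted). -/
  l : Option tm.Λ
  /-- The internal state at the block's start. -/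
  var : tm.σ
  /-- The heights at the block's start. -/
  ht : tm.K → ℕ
  /-- The claimed minimal boundary height of each stack during the block. -/
  mn : tm.K → ℕ
  /-- The claimed maximal boundary height of each stack during the block. -/
  mx : tm.K → ℕ
  /-- The claimed contents above the cut at the block's start. -/
  frag : ∀ k, List (tm.Γ k)
  /-- The claimed contents above the (same) cut at the block's end. -/
  efrag : ∀ k, List (tm.Γ k)

variable {tm}

namespace BlockClaim

/-- The claimed lowest touched height block. [folklore] -/
noncomputable def loC (b : ℕ) (C : BlockClaim tm) (k : tm.K) : ℕ :=
  (C.mn k - TM2Comp.machinePopBound tm - b * TM2Comp.machinePopBound tm) / blockβ tm b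

/-- The claimed highest touched height block. [folklore] -/
noncomputable def hiC (b : ℕ) (C : BlockClaim tm) (k : tm.K) : ℕ :=
  (C.mx k + TM2Comp.machinePushBound tm) / blockβ tm b

/-- The claimed cut: the bottom of the lowest touched height block. [folklore] -/
noncomputable def cutC (b : ℕ) (C : BlockClaim tm) (k : tm.K) : ℕ := C.loC b k * blockβ tm b

/-- The truncated start configuration of the claim. [folklore] -/
def startCfg (C : BlockClaim tm) : tm.Cfg := ⟨C.l, C.var, C.frag⟩

end BlockClaim

/-! ### The three local conditions -/

section Conditions

/-- **(C0) The first block starts in the initial configuration**, its contents above its own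
claimed cut read off `c₀`. [cite: PaulEtAl1983, §3] -/
def CondInit (c₀ : tm.Cfg) (b : ℕ) (Γ : ℕ → BlockClaim tm) : Prop :=
  (Γ 0).l = c₀.l ∧ (Γ 0).var = c₀.var ∧ (∀ k, (Γ 0).ht k = (c₀.stk k).length) ∧
    ∀ k, (Γ 0).frag k = above ((Γ 0).cutC b k) (c₀.stk k)

/-- **(C1) Local re-simulation of block `j`.** With `U t` the truncated run from the claimed start
configuration: (a) the start contents fit the start heights above the cut; (r) static room:
`b Q + Q` symbols above every positive cut at the start (so `Q` remain before each of the `b`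
steps, whatever they pop — no run-time monitoring needed); (b, c) the next claim's control and heights are those
reached; (d) the end contents are those reached; (e) the claimed extreme heights are the extreme
truncated boundary heights lifted by the cut; (f) the start height is covered by the claimed
touched height blocks. [cite: PaulEtAl1983, §3] -/
def CondSim (b : ℕ) (Γ : ℕ → BlockClaim tm) (j : ℕ) : Prop :=
  let C := Γ j
  let U : ℕ → tm.Cfg := run tm C.startCfg
  (∀ k, (C.frag k).length + C.cutC b k = C.ht k) ∧
  (∀ k, 0 < C.loC b k →
      b * TM2Comp.machinePopBound tm + TM2Comp.machinePopBound tm ≤ (C.frag k).length) ∧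
  ((Γ (j + 1)).l = (U b).l ∧ (Γ (j + 1)).var = (U b).var) ∧
  (∀ k, (Γ (j + 1)).ht k = ((U b).stk k).length + C.cutC b k) ∧
  (∀ k, C.efrag k = (U b).stk k) ∧
  (∀ k, (∀ t, t ≤ b → C.mn k ≤ C.cutC b k + ((U t).stk k).length) ∧
        (∃ t, t ≤ b ∧ C.mn k = C.cutC b k + ((U t).stk k).length) ∧
        (∀ t, t ≤ b → C.cutC b k + ((U t).stk k).length ≤ C.mx k) ∧
        (∃ t, t ≤ b ∧ C.mx k = C.cutC b k + ((U t).stk k).length)) ∧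
  (∀ k, C.ht k ≤ (C.hiC b k + 1) * blockβ tm b)

/-- **(C2) Dependencies of block `j`.** Every height block `B` the block claims to touch carries,
at the block's start, the content it had at the end of its last claimed toucher before `j` — or
the initial content. [cite: PaulEtAl1983, §3] [cite: Santhanam2001, §1 (p. 2, the edges of the computation graph)] -/
def CondDep (c₀ : tm.Cfg) (b : ℕ) (Γ : ℕ → BlockClaim tm) (j : ℕ) : Prop :=
  ∀ k B, (Γ j).loC b k ≤ B → B ≤ (Γ j).hiC b k →
    bpartAbove (blockβ tm b) ((Γ j).cutC b k) B ((Γ j).frag k) =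
      match lastToucher (fun m => (Γ m).loC b k) (fun m => (Γ m).hiC b k) j B with
      | some i => bpartAbove (blockβ tm b) ((Γ i).cutC b k) B ((Γ i).efrag k)
      | none => bpart (blockβ tm b) B (c₀.stk k)

end Conditions

/-! ### Correctness predicates -/

/-- The claim `j` has the true start control and heights, and its start contents are the true
contents above ITS OWN claimed cut. [folklore] -/
def Correct (c₀ : tm.Cfg) (b : ℕ) (Γ : ℕ → BlockClaim tm) (j : ℕ) : Prop :=
  (Γ j).l = (run tm c₀ (j * b)).l ∧ (Γ j).var = (run tm c₀ (j * b)).var ∧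
    (∀ k, (Γ j).ht k = ((run tm c₀ (j * b)).stk k).length) ∧
    ∀ k, (Γ j).frag k = above ((Γ j).cutC b k) ((run tm c₀ (j * b)).stk k)

/-- The claim `j` is, moreover, right about its extreme heights (hence about `lo`, `hi`, its cut)
and its end contents. [folklore] -/
def FullyCorrect (c₀ : tm.Cfg) (b : ℕ) (Γ : ℕ → BlockClaim tm) (j : ℕ) : Prop :=
  Correct c₀ b Γ j ∧ (∀ k, (Γ j).mn k = minH tm c₀ b k j) ∧ (∀ k, (Γ j).mx k = maxH tm c₀ b k j) ∧
    ∀ k, (Γ j).efrag k = above (lo tm c₀ b k j * blockβ tm b) ((run tm c₀ ((j + 1) * b)).stk k)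

variable {c₀ : tm.Cfg} {b : ℕ} {Γ : ℕ → BlockClaim tm}

/-- A fully correct claim has the true `lo`. [folklore] -/
theorem FullyCorrect.loC_eq {j : ℕ} (h : FullyCorrect c₀ b Γ j) (k : tm.K) :
    (Γ j).loC b k = lo tm c₀ b k j := by
  unfold BlockClaim.loC lo; rw [h.2.1 k]

/-- A fully correct claim has the true `hi`. [folklore] -/
theorem FullyCorrect.hiC_eq {j : ℕ} (h : FullyCorrect c₀ b Γ j) (k : tm.K) :
    (Γ j).hiC b k = hi tm c₀ b k j := by
  unfold BlockClaim.hiC hi; rw [h.2.2.1 k]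

/-- A fully correct claim has the true cut. [folklore] -/
theorem FullyCorrect.cutC_eq {j : ℕ} (h : FullyCorrect c₀ b Γ j) (k : tm.K) :
    (Γ j).cutC b k = lo tm c₀ b k j * blockβ tm b := by
  unfold BlockClaim.cutC; rw [h.loC_eq]

/-! ### Soundness of the local re-simulation (C1) -/

/-- **The true run across a correct, locally re-simulated block** is the truncated run from the
claimed start configuration with the true hidden bottoms appended (`run_append_of_truncated`, the
room coming from (r)). [cite: PaulEtAl1983, §3] -/
theorem true_run_block {j : ℕ} (hc : Correct c₀ b Γ j) (hs : CondSim b Γ j) :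
    letI := tm.kDecidableEq
    ∀ t, t ≤ b → run tm c₀ (j * b + t) =
      TM2Frames.appendBot (fun k => below ((Γ j).cutC b k) ((run tm c₀ (j * b)).stk k))
        (run tm (Γ j).startCfg t) := by
  letI := tm.kDecidableEq
  obtain ⟨hl, hv, hht, hfrag⟩ := hc
  obtain ⟨ha, hr, -, -, -, -, -⟩ := hs
  intro t ht
  set d := run tm c₀ (j * b) with hd'
  set L : ∀ k, List (tm.Γ k) := fun k => below ((Γ j).cutC b k) (d.stk k) with hLdef
  have hθle : ∀ k, (Γ j).cutC b k ≤ (d.stk k).length := fun k => by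
    have := ha k; rw [hht k] at this; omega
  have hL : ∀ k, (L k).length = (Γ j).cutC b k := fun k => length_below (hθle k)
  have hsplit : d = TM2Frames.appendBot L (Γ j).startCfg := by
    obtain ⟨dl, dv, dS⟩ := d
    simp only [BlockClaim.startCfg, TM2Frames.appendBot_mk]
    simp only at hl hv hfrag
    rw [hl, hv]
    congr 1
    funext k
    rw [hfrag k]
    exact (above_append_below _ _).symm
  have hroom : ∀ t, t < b → ∀ k, L k ≠ [] →
      TM2Comp.machinePopBound tm ≤ ((run tm (Γ j).startCfg t).stk k).length := by
    intro t ht k hk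
    have hpos : 0 < (Γ j).loC b k := Nat.pos_of_ne_zero fun h0 => hk (by
      apply List.eq_nil_of_length_eq_zero
      rw [hL]; simp [BlockClaim.cutC, h0])
    -- static room: `b Q + Q ≤ |frag k|`, and `t < b` steps pop at most `Q t`
    have h1 := hr k hpos
    have h2 := le_height_of_le (Γ j).startCfg k 0 t
    rw [Nat.zero_add] at h2
    have h3 : TM2Comp.machinePopBound tm * t ≤ b * TM2Comp.machinePopBound tm := by
      rw [Nat.mul_comm]; exact Nat.mul_le_mul_right _ ht.le
    change ((Γ j).frag k).length ≤ ((run tm (Γ j).startCfg t).stk k).length + _ at h2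
    omega
  rw [run_add, ← hd', hsplit]
  exact TM2Frames.run_append_of_truncated _ L b hroom t ht

/-- **(C1) is sound**: a correct claim passing the local re-simulation is fully correct, and the
next claim has the true control and heights. [cite: PaulEtAl1983, §3] -/
theorem correct_step {j : ℕ} (hc : Correct c₀ b Γ j) (hs : CondSim b Γ j) :
    FullyCorrect c₀ b Γ j ∧
      ((Γ (j + 1)).l = (run tm c₀ ((j + 1) * b)).l ∧
        (Γ (j + 1)).var = (run tm c₀ ((j + 1) * b)).var ∧
        ∀ k, (Γ (j + 1)).ht k = ((run tm c₀ ((j + 1) * b)).stk k).length) := by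
  letI := tm.kDecidableEq
  have htrue := true_run_block hc hs
  obtain ⟨hl, hv, hht, hfrag⟩ := hc
  obtain ⟨ha, -, ⟨hb1, hb2⟩, hcc, hd, he, -⟩ := hs
  set C := Γ j with hC
  set θ : tm.K → ℕ := fun k => C.cutC b k with hθ
  have hθle : ∀ k, θ k ≤ ((run tm c₀ (j * b)).stk k).length := fun k => by
    have := ha k; rw [hht k] at this; simp only [hθ]; omega
  have hL : ∀ k, (below (C.cutC b k) ((run tm c₀ (j * b)).stk k)).length = θ k :=
    fun k => length_below (hθle k)
  -- heights across the block
  have hlen : ∀ t, t ≤ b → ∀ k,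
      ((run tm c₀ (j * b + t)).stk k).length = ((run tm C.startCfg t).stk k).length + θ k := by
    intro t ht k
    rw [htrue t ht, TM2Frames.appendBot_stk, List.length_append, hL]
  have hend := htrue b le_rfl
  rw [show j * b + b = (j + 1) * b by ring] at hend
  -- the extreme heights
  have hmn : ∀ k, C.mn k = minH tm c₀ b k j := fun k => by
    obtain ⟨h1, ⟨t₀, ht₀, h2⟩, -, -⟩ := he k
    apply le_antisymm
    · refine Finset.le_inf' _ _ fun t ht => ?_
      simp only [Finset.mem_range] at ht
      unfold height
      rw [hlen t (by omega) k, Nat.add_comm]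
      exact h1 t (by omega)
    · refine (Finset.inf'_le _ (by simpa [Nat.lt_succ_iff] using ht₀)).trans ?_
      unfold height
      rw [hlen t₀ ht₀ k, h2, Nat.add_comm]
  have hmx : ∀ k, C.mx k = maxH tm c₀ b k j := fun k => by
    obtain ⟨-, -, h1, ⟨t₀, ht₀, h2⟩⟩ := he k
    apply le_antisymm
    · refine le_trans ?_ (Finset.le_sup' (fun dd => height tm c₀ k (j * b + dd))
        (by simpa [Nat.lt_succ_iff] using ht₀))
      unfold height
      rw [hlen t₀ ht₀ k, h2, Nat.add_comm]
    · refine Finset.sup'_le _ _ fun t ht => ?_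
      simp only [Finset.mem_range] at ht
      unfold height
      rw [hlen t (by omega) k, Nat.add_comm]
      exact h1 t (by omega)
  have hfull : FullyCorrect c₀ b Γ j := by
    refine ⟨⟨hl, hv, hht, hfrag⟩, hmn, hmx, fun k => ?_⟩
    -- the cut is the true cut, the end contents are the truncated end stacks
    have hcut : C.cutC b k = lo tm c₀ b k j * blockβ tm b := by
      unfold BlockClaim.cutC BlockClaim.loC lo; rw [hmn k]
    rw [← hcut, hd k, hend, TM2Frames.appendBot_stk]
    have happ := above_append ((run tm C.startCfg b).stk k)
      (below (C.cutC b k) ((run tm c₀ (j * b)).stk k))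
    rw [hL k] at happ
    exact happ.symm
  refine ⟨hfull, ?_, ?_, fun k => ?_⟩
  · rw [hb1, hend]; rfl
  · rw [hb2, hend]; rfl
  · rw [hcc k, hend, TM2Frames.appendBot_stk, List.length_append, hL]

/-! ### Soundness of the dependency checks (C2) -/

/-- Claimed and true `lo`/`hi` agree below `j`, hence so do the last touchers. [folklore] -/
theorem lastToucher_claims_eq' {j : ℕ}
    (hlohi : ∀ m, m < j → (∀ k, (Γ m).loC b k = lo tm c₀ b k m) ∧ ∀ k, (Γ m).hiC b k = hi tm c₀ b k m)
    (k : tm.K) (B : ℕ) :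
    lastToucher (fun m => (Γ m).loC b k) (fun m => (Γ m).hiC b k) j B =
      lastToucher (lo tm c₀ b k) (hi tm c₀ b k) j B := by
  unfold lastToucher
  congr 1
  ext m
  simp only [Finset.mem_filter, Finset.mem_range, Touches, and_congr_right_iff]
  intro hm
  rw [(hlohi m hm).1 k, (hlohi m hm).2 k]

/-- Claimed and true `lo`/`hi` agree below `j` when all earlier claims are fully correct, hence so
do the last touchers. [folklore] -/
theorem lastToucher_claims_eq {j : ℕ} (hall : ∀ m, m < j → FullyCorrect c₀ b Γ m) (k : tm.K)
    (B : ℕ) :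
    lastToucher (fun m => (Γ m).loC b k) (fun m => (Γ m).hiC b k) j B =
      lastToucher (lo tm c₀ b k) (hi tm c₀ b k) j B :=
  lastToucher_claims_eq' (fun m hm => ⟨(hall m hm).loC_eq, (hall m hm).hiC_eq⟩) k B

/-- **(C2) is sound, local form.** If the claimed `lo`/`hi` of all blocks before `j` are the true
ones, the end contents and cuts claimed for the LAST TOUCHERS of the height blocks `j` claims to
touch are the true ones, claim `j` has the true heights and passes (C1a), (C1f) and (C2), then its
start contents are the true contents above its claimed cut. Every height block `B ∈ [lo', hi']` of
the claim reads, off the claimed start contents, the end contents of the last (claimed = true)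
toucher, i.e. the true content of `B` at time `j b` (`bpart_run_eq_of_lastToucher`); these height
blocks cover the claimed start contents, which are therefore the true ones (`eq_of_bpartAbove_eq`).
(This local form — hypotheses only on the predecessors actually consulted — is what the
four-alternation protocol, whose heavy data are supplied branch by branch, needs.)
[cite: PaulEtAl1983, §3] -/
theorem frag_correct_of_condDep' {j : ℕ}
    (hlohi : ∀ m, m < j → (∀ k, (Γ m).loC b k = lo tm c₀ b k m) ∧ ∀ k, (Γ m).hiC b k = hi tm c₀ b k m)
    (hpred : ∀ k B i, (Γ j).loC b k ≤ B → B ≤ (Γ j).hiC b k →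
      lastToucher (lo tm c₀ b k) (hi tm c₀ b k) j B = some i →
        (Γ i).cutC b k = lo tm c₀ b k i * blockβ tm b ∧
          (Γ i).efrag k = above (lo tm c₀ b k i * blockβ tm b) ((run tm c₀ ((i + 1) * b)).stk k))
    (hht : ∀ k, (Γ j).ht k = ((run tm c₀ (j * b)).stk k).length)
    (ha : ∀ k, ((Γ j).frag k).length + (Γ j).cutC b k = (Γ j).ht k)
    (hf : ∀ k, (Γ j).ht k ≤ ((Γ j).hiC b k + 1) * blockβ tm b) (hdep : CondDep c₀ b Γ j) (k : tm.K) :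
    (Γ j).frag k = above ((Γ j).cutC b k) ((run tm c₀ (j * b)).stk k) := by
  have hθle : (Γ j).cutC b k ≤ ((run tm c₀ (j * b)).stk k).length := by
    have := ha k; rw [hht k] at this; omega
  have hL : (below ((Γ j).cutC b k) ((run tm c₀ (j * b)).stk k)).length = (Γ j).cutC b k :=
    length_below hθle
  refine eq_of_bpartAbove_eq (β := blockβ tm b) (lo := (Γ j).loC b k) (hi := (Γ j).hiC b k)
    _ _ ?_ ?_ fun B hlo hhi => ?_
  · rw [length_above]; have := ha k; rw [hht k] at this; omega
  · show ((Γ j).frag k).length + (Γ j).cutC b k ≤ _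
    rw [ha k]; exact hf k
  · -- the height block `B` read off the claim and off the truth
    have hcutle : (Γ j).cutC b k ≤ B * blockβ tm b := Nat.mul_le_mul_right _ hlo
    have key : bpartAbove (blockβ tm b) ((Γ j).cutC b k) B
        (above ((Γ j).cutC b k) ((run tm c₀ (j * b)).stk k)) =
        bpart (blockβ tm b) B ((run tm c₀ (j * b)).stk k) := by
      conv_rhs => rw [← above_append_below ((Γ j).cutC b k) ((run tm c₀ (j * b)).stk k)]
      exact (bpart_append_eq_bpartAbove _ _ hL hcutle).symm
    rw [show (Γ j).loC b k * blockβ tm b = (Γ j).cutC b k from rfl, key, hdep k B hlo hhi,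
      lastToucher_claims_eq' hlohi k B]
    cases hlt : lastToucher (lo tm c₀ b k) (hi tm c₀ b k) j B with
    | none =>
      simp only
      exact (bpart_run_eq_init_of_lastToucher_none c₀ b k hlt).symm
    | some i =>
      simp only
      obtain ⟨hij, hti, -⟩ := lastToucher_spec hlt
      obtain ⟨hcuti_eq, hefragi⟩ := hpred k B i hlo hhi hlt
      -- `B ≥ lo i` since `i` touches `B`
      have hcuti : (Γ i).cutC b k ≤ B * blockβ tm b := by
        rw [hcuti_eq]; exact Nat.mul_le_mul_right _ hti.1
      have hθle' : lo tm c₀ b k i * blockβ tm b ≤ ((run tm c₀ ((i + 1) * b)).stk k).length := by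
        -- the end height of block `i` dominates its cut
        have h1 := height_block_ge_minH c₀ b k i b le_rfl
        rw [show i * b + b = (i + 1) * b by ring] at h1
        rcases Nat.eq_zero_or_pos (lo tm c₀ b k i) with hz | hz
        · rw [hz]; simp
        · have := loβ_add_le_minH c₀ b k i hz; omega
      have hL' : (below (lo tm c₀ b k i * blockβ tm b) ((run tm c₀ ((i + 1) * b)).stk k)).length =
          lo tm c₀ b k i * blockβ tm b := length_below hθle'
      rw [hefragi, hcuti_eq, bpart_run_eq_of_lastToucher c₀ b k hlt]
      conv_rhs => rw [← above_append_below (lo tm c₀ b k i * blockβ tm b)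
        ((run tm c₀ ((i + 1) * b)).stk k)]
      rw [bpart_append_eq_bpartAbove _ _ hL' (by rw [← hcuti_eq]; exact hcuti)]

/-- **(C2) is sound**: if all claims before `j` are fully correct, claim `j` has the true heights
and passes (C1a), (C1f) and (C2), then its start contents are the true contents above its claimed
cut (`frag_correct_of_condDep'` with the hypotheses discharged from full correctness).
[cite: PaulEtAl1983, §3] -/
theorem frag_correct_of_condDep {j : ℕ} (hall : ∀ m, m < j → FullyCorrect c₀ b Γ m)
    (hht : ∀ k, (Γ j).ht k = ((run tm c₀ (j * b)).stk k).length)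
    (ha : ∀ k, ((Γ j).frag k).length + (Γ j).cutC b k = (Γ j).ht k)
    (hf : ∀ k, (Γ j).ht k ≤ ((Γ j).hiC b k + 1) * blockβ tm b) (hdep : CondDep c₀ b Γ j) (k : tm.K) :
    (Γ j).frag k = above ((Γ j).cutC b k) ((run tm c₀ (j * b)).stk k) :=
  frag_correct_of_condDep' (fun m hm => ⟨(hall m hm).loC_eq, (hall m hm).hiC_eq⟩)
    (fun k B i _ _ hlt => by
      obtain ⟨hij, -, -⟩ := lastToucher_spec hlt
      exact ⟨(hall i hij).cutC_eq k, (hall i hij).2.2.2 k⟩)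
    hht ha hf hdep k

/-! ### Soundness -/

/-- **Soundness of the local checks.** If the claims satisfy (C0), the local re-simulation (C1)
for every block `j < N` and the dependency checks (C2) for every block `j ≤ N`, then every claim
`j < N` is fully correct, and claim `N` has the true control and heights: the guesses of the
existential player are forced to the true run. [cite: PaulEtAl1983, §3 (correctness of the Σ₄ simulation)] -/
theorem sound (N : ℕ) (h0 : CondInit c₀ b Γ) (h1 : ∀ j, j < N → CondSim b Γ j)
    (h2 : ∀ j, j ≤ N → CondDep c₀ b Γ j) :
    (∀ j, j < N → FullyCorrect c₀ b Γ j) ∧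
      ((Γ N).l = (run tm c₀ (N * b)).l ∧ (Γ N).var = (run tm c₀ (N * b)).var ∧
        ∀ k, (Γ N).ht k = ((run tm c₀ (N * b)).stk k).length) := by
  -- the invariant up to `n ≤ N`
  suffices H : ∀ n, n ≤ N → (∀ j, j < n → FullyCorrect c₀ b Γ j) ∧
      ((Γ n).l = (run tm c₀ (n * b)).l ∧ (Γ n).var = (run tm c₀ (n * b)).var ∧
        ∀ k, (Γ n).ht k = ((run tm c₀ (n * b)).stk k).length) from H N le_rfl
  intro n
  induction n with
  | zero =>
    intro _
    refine ⟨fun j hj => (Nat.not_lt_zero j hj).elim, ?_⟩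
    obtain ⟨hl, hv, hht, -⟩ := h0
    simp only [Nat.zero_mul, run, Function.iterate_zero, id_eq]
    exact ⟨hl, hv, hht⟩
  | succ n ih =>
    intro hn
    obtain ⟨hall, hl, hv, hht⟩ := ih (by omega)
    -- claim `n` is correct: control/heights by the invariant, contents by (C0) or (C2)
    have hsim := h1 n (by omega)
    have hcorr : Correct c₀ b Γ n := by
      refine ⟨hl, hv, hht, ?_⟩
      rcases Nat.eq_zero_or_pos n with rfl | hpos
      · obtain ⟨-, -, -, hfrag⟩ := h0
        simpa [run] using hfrag
      · exact frag_correct_of_condDep hall hht hsim.1 hsim.2.2.2.2.2.2 (h2 n (by omega))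
    obtain ⟨hfull, hnext⟩ := correct_step hcorr hsim
    refine ⟨fun j hj => ?_, hnext⟩
    rcases Nat.lt_succ_iff_lt_or_eq.1 hj with hj | rfl
    · exact hall j hj
    · exact hfull

end TM2Blocks

end Literature.Computability.Complexity
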